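/-
Copyright: literature formalisation for the harness. Statements follow the cited text.
-/
import Mathlib.NumberTheory.Real.Irrational
import Mathlib.Analysis.SpecificLimits.Basic
import Mathlib.Data.ZMod.Basic
import HarnessLib

/-!
# Cossart–Piltant I (2008), Lemma 9.4 — the lattice step: the Euclidean algorithm on two coins

Second of three files (`LatticeMoves2008`, this file, `LatticeReservoir2008`) giving a kernel
proof of `CP2008.LatticeABC d l t w` for every `d ≥ 3` (HAL hal-00139124, proof of Lemma 9.4,
p. 30, l. 23–31; [CossartPiltant2008] Lemma 9.2). This file is the real-analysis half, with no
matrices: the Euclidean algorithm on a pair of positive reals `(x₀, x₁)` with irrational ratio.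

* `Lattice94.erem`, `Lattice94.equot` — remainders `rₙ` and quotients `qₙ = ⌊rₙ/rₙ₊₁⌋`
  (`r₀ = x₀`, `r₁ = x₁`, `rₙ₊₂ = rₙ − qₙ rₙ₊₁`); `Lattice94.echar` — the charges
  `uₙ₊₂ = uₙ − qₙ uₙ₊₁ ∈ ℤ/l` carried along.
* `chain_inv`, `erem_pos`, `erem_lt`, `erem_anti`, `erem_half`, `erem_pow`, `erem_small`:
  positivity, strict decrease, `rₙ₊₃ ≤ rₙ₊₁/2`, hence `rₙ → 0`.
* local coefficients `lA`, `lB` with `r_{n+s} = A_s rₙ + B_s rₙ₊₁` (`erem_eq_lin`), the growth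
  bound `|A_s| ≤ Kˢ` when all quotients `q_j ≤ K − 1` for `j ≥ n` (`abs_lA_le`), and `A_s ≠ 0`
  for `s ≥ 2` (`lA_ne_zero`).
* `exists_fract_mem`: stepping a real number by `±δ` (`0 < δ ≤ L < 1`), its fractional part
  lands in `(0, L]` within `δ⁻¹ + 1` steps — the only "Diophantine" input of the reservoir
  argument (no continued-fraction theory is used).

Design note. The quotients `equot x₀ x₁ n` are the partial quotients of the continued fraction
of `x₀/x₁` (Mathlib: `GenContFract.of`, `GenContFract.IntFractPair.stream`), but nothing of that
theory is used or restated: the reservoir argument needs the two-term recursion on REMAINDERS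
from an arbitrary starting index `n` with its integer coefficients `(A_s, B_s)` and the crude
bounds `|A_s| ≤ Kˢ`, `A_s ≠ 0`, together with the charges `uₙ ∈ ℤ/l` carried along — a
bookkeeping that Mathlib's convergents API does not provide and that is shorter to set up
directly (about forty lines of recursion lemmas).

Cell record: pub-hironaka GAPS §GA G7-A21.L / F2-(ii). Nothing in this file refers to, let
alone contradicts, a statement of [CossartPiltant2008].

## Sources

* V. Cossart, O. Piltant, J. Algebra 320 (2008), Lemma 9.2 = HAL hal-00139124 Lemma 9.4, proof,
  p. 30, l. 23–31. [CossartPiltant2008]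
-/

noncomputable section

namespace Literature.AlgebraicGeometry.CossartPiltant200819.CP2008

namespace Lattice94

/-! ### The Euclidean algorithm on a pair of positive reals -/

section Chain

variable (x₀ x₁ : ℝ)

/-- Consecutive remainders `(rₙ, rₙ₊₁)` of the Euclidean algorithm started at `(x₀, x₁)`:
`rₙ₊₂ = rₙ − ⌊rₙ/rₙ₊₁⌋ rₙ₊₁`. [folklore] -/
def epair : ℕ → ℝ × ℝ
  | 0 => (x₀, x₁)
  | n + 1 => ((epair n).2, (epair n).1 - (⌊(epair n).1 / (epair n).2⌋₊ : ℝ) * (epair n).2)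

/-- The `n`-th remainder `rₙ`. [folklore] -/
def erem (n : ℕ) : ℝ := (epair x₀ x₁ n).1

/-- The `n`-th quotient `qₙ = ⌊rₙ/rₙ₊₁⌋`. [folklore] -/
def equot (n : ℕ) : ℕ := ⌊erem x₀ x₁ n / erem x₀ x₁ (n + 1)⌋₊

/-- `r₀ = x₀`. [folklore] -/
theorem erem_zero : erem x₀ x₁ 0 = x₀ := rfl

/-- `r₁ = x₁`. [folklore] -/
theorem erem_one : erem x₀ x₁ 1 = x₁ := rfl

/-- `rₙ₊₂ = rₙ − qₙ rₙ₊₁`. [folklore] -/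
theorem erem_add_two (n : ℕ) :
    erem x₀ x₁ (n + 2) = erem x₀ x₁ n - (equot x₀ x₁ n : ℝ) * erem x₀ x₁ (n + 1) := rfl

variable {l : ℕ} (u₀ u₁ : ZMod l)

/-- Consecutive charges `(uₙ, uₙ₊₁)` along the Euclidean algorithm: `uₙ₊₂ = uₙ − qₙ uₙ₊₁`.
[folklore] -/
def cpair : ℕ → ZMod l × ZMod l
  | 0 => (u₀, u₁)
  | n + 1 => ((cpair n).2, (cpair n).1 - (equot x₀ x₁ n : ZMod l) * (cpair n).2)

/-- The `n`-th charge `uₙ`. [folklore] -/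
def echar (n : ℕ) : ZMod l := (cpair x₀ x₁ u₀ u₁ n).1

/-- `u₀`. [folklore] -/
theorem echar_zero : echar x₀ x₁ u₀ u₁ 0 = u₀ := rfl

/-- `u₁`. [folklore] -/
theorem echar_one : echar x₀ x₁ u₀ u₁ 1 = u₁ := rfl

/-- `uₙ₊₂ = uₙ − qₙ uₙ₊₁`. [folklore] -/
theorem echar_add_two (n : ℕ) :
    echar x₀ x₁ u₀ u₁ (n + 2) =
      echar x₀ x₁ u₀ u₁ n - (equot x₀ x₁ n : ZMod l) * echar x₀ x₁ u₀ u₁ (n + 1) := rfl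

variable {x₀ x₁}

/-- The invariant of the Euclidean algorithm on a pair with irrational ratio: all remainders are
positive and consecutive ratios stay irrational (`rₙ₊₁/rₙ₊₂ = (rₙ/rₙ₊₁ − qₙ)⁻¹`). [folklore] -/
theorem chain_inv (hx : Irrational (x₀ / x₁)) (h0 : 0 < x₀) (h1 : 0 < x₁) (n : ℕ) :
    0 < erem x₀ x₁ n ∧ 0 < erem x₀ x₁ (n + 1) ∧
      Irrational (erem x₀ x₁ n / erem x₀ x₁ (n + 1)) := by
  induction n with
  | zero => exact ⟨h0, h1, hx⟩
  | succ n ih =>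
    obtain ⟨ha, hb, hirr⟩ := ih
    have hq : (equot x₀ x₁ n : ℝ) * erem x₀ x₁ (n + 1) ≤ erem x₀ x₁ n := by
      have := Nat.floor_le (div_nonneg ha.le hb.le)
      unfold equot
      rwa [le_div_iff₀ hb] at this
    have hne : erem x₀ x₁ (n + 2) ≠ 0 := by
      intro h
      rw [erem_add_two] at h
      apply hirr.ne_nat (equot x₀ x₁ n)
      rw [div_eq_iff hb.ne']
      linarith
    have hpos : 0 < erem x₀ x₁ (n + 2) := by
      rcases lt_or_eq_of_le (show 0 ≤ erem x₀ x₁ (n + 2) by rw [erem_add_two]; linarith)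
        with h | h
      · exact h
      · exact absurd h.symm hne
    refine ⟨hb, hpos, ?_⟩
    have key : erem x₀ x₁ (n + 1) / erem x₀ x₁ (n + 2) =
        (erem x₀ x₁ n / erem x₀ x₁ (n + 1) - (equot x₀ x₁ n : ℝ))⁻¹ := by
      rw [erem_add_two]
      field_simp
    rw [key]
    exact (hirr.sub_natCast _).inv

/-- All remainders are positive. [folklore] -/
theorem erem_pos (hx : Irrational (x₀ / x₁)) (h0 : 0 < x₀) (h1 : 0 < x₁) (n : ℕ) :
    0 < erem x₀ x₁ n :=
  (chain_inv hx h0 h1 n).1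

/-- `qₙ rₙ₊₁ ≤ rₙ` (the Euclid step is a legal move). [folklore] -/
theorem equot_mul_le (hx : Irrational (x₀ / x₁)) (h0 : 0 < x₀) (h1 : 0 < x₁) (n : ℕ) :
    (equot x₀ x₁ n : ℝ) * erem x₀ x₁ (n + 1) ≤ erem x₀ x₁ n := by
  have := Nat.floor_le (div_nonneg (erem_pos hx h0 h1 n).le (erem_pos hx h0 h1 (n + 1)).le)
  unfold equot
  rwa [le_div_iff₀ (erem_pos hx h0 h1 (n + 1))] at this

/-- `rₙ₊₂ < rₙ₊₁`. [folklore] -/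
theorem erem_lt (hx : Irrational (x₀ / x₁)) (h0 : 0 < x₀) (h1 : 0 < x₁) (n : ℕ) :
    erem x₀ x₁ (n + 2) < erem x₀ x₁ (n + 1) := by
  have hb := erem_pos hx h0 h1 (n + 1)
  have := Nat.lt_floor_add_one (erem x₀ x₁ n / erem x₀ x₁ (n + 1))
  rw [div_lt_iff₀ hb] at this
  rw [erem_add_two]
  unfold equot
  linarith

/-- The remainders are antitone from index `1` on. [folklore] -/
theorem erem_anti (hx : Irrational (x₀ / x₁)) (h0 : 0 < x₀) (h1 : 0 < x₁) {a b : ℕ}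
    (hab : a ≤ b) : erem x₀ x₁ (b + 1) ≤ erem x₀ x₁ (a + 1) := by
  induction b, hab using Nat.le_induction with
  | base => exact le_rfl
  | succ b _ ih => exact le_trans (erem_lt hx h0 h1 b).le ih

/-- `rₙ₊₃ ≤ rₙ₊₁ / 2`. [folklore] -/
theorem erem_half (hx : Irrational (x₀ / x₁)) (h0 : 0 < x₀) (h1 : 0 < x₁) (n : ℕ) :
    erem x₀ x₁ (n + 3) ≤ erem x₀ x₁ (n + 1) / 2 := by
  have ha := erem_pos hx h0 h1 (n + 1)
  have hb := erem_pos hx h0 h1 (n + 2)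
  have hc := erem_pos hx h0 h1 (n + 3)
  have hlt := erem_lt hx h0 h1 n
  have hlt' := erem_lt hx h0 h1 (n + 1)
  have hq1 : (1 : ℝ) ≤ (equot x₀ x₁ (n + 1) : ℝ) := by
    have : 1 ≤ equot x₀ x₁ (n + 1) := by
      unfold equot
      rw [Nat.one_le_floor_iff, le_div_iff₀ hb]
      linarith
    exact_mod_cast this
  have h3 : erem x₀ x₁ (n + 3) = erem x₀ x₁ (n + 1) -
      (equot x₀ x₁ (n + 1) : ℝ) * erem x₀ x₁ (n + 2) := erem_add_two x₀ x₁ (n + 1)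
  by_cases hcase : erem x₀ x₁ (n + 2) ≤ erem x₀ x₁ (n + 1) / 2
  · linarith
  · nlinarith

/-- Geometric decay: `r_{n+1+2s} ≤ r_{n+1} / 2ˢ`. [folklore] -/
theorem erem_pow (hx : Irrational (x₀ / x₁)) (h0 : 0 < x₀) (h1 : 0 < x₁) (n s : ℕ) :
    erem x₀ x₁ (n + 1 + 2 * s) ≤ erem x₀ x₁ (n + 1) / 2 ^ s := by
  induction s with
  | zero => simp
  | succ s ih =>
    have h := erem_half hx h0 h1 (n + 2 * s)
    have e1 : n + 1 + 2 * (s + 1) = n + 2 * s + 3 := by ring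
    have e2 : n + 2 * s + 1 = n + 1 + 2 * s := by ring
    rw [e1, pow_succ, div_mul_eq_div_div]
    rw [e2] at h
    linarith [div_le_div_of_nonneg_right ih (by norm_num : (0:ℝ) ≤ 2)]

/-- The remainders become arbitrarily small. [folklore] -/
theorem erem_small (hx : Irrational (x₀ / x₁)) (h0 : 0 < x₀) (h1 : 0 < x₁) {ε : ℝ}
    (hε : 0 < ε) : ∃ N, ∀ n, N ≤ n → erem x₀ x₁ n < ε := by
  obtain ⟨s, hs⟩ := exists_pow_lt_of_lt_one (div_pos hε h1) (by norm_num : (1 / 2 : ℝ) < 1)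
  refine ⟨1 + 2 * s, fun n hn => ?_⟩
  obtain ⟨b, rfl⟩ : ∃ b, n = b + 1 := ⟨n - 1, by omega⟩
  have h2 := erem_anti hx h0 h1 (a := 2 * s) (b := b) (by omega)
  have h3 := erem_pow hx h0 h1 0 s
  rw [zero_add, erem_one] at h3
  have e : 2 * s + 1 = 1 + 2 * s := by ring
  rw [e] at h2
  have h4 : x₁ / 2 ^ s < ε := by
    rw [one_div, inv_pow, lt_div_iff₀ h1] at hs
    rw [div_lt_iff₀ (by positivity)]
    calc x₁ = x₁ * (2 ^ s)⁻¹ * 2 ^ s := by field_simp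
      _ < ε * 2 ^ s := by
        have := mul_lt_mul_of_pos_right hs (by positivity : (0:ℝ) < 2 ^ s)
        rwa [mul_comm ((2:ℝ) ^ s)⁻¹ x₁] at this
  linarith

/-! ### Local coefficients: `r_{n+s} = A_s r_n + B_s r_{n+1}` -/

variable (x₀ x₁)

/-- The pairs `((A_s, B_s), (A_{s+1}, B_{s+1}))` of integer coefficients expressing `r_{n+s}`,
`r_{n+s+1}` in terms of `r_n, r_{n+1}`: `A_{s+2} = A_s − q_{n+s} A_{s+1}`. [folklore] -/
def lpair (n : ℕ) : ℕ → (ℤ × ℤ) × (ℤ × ℤ)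
  | 0 => ((1, 0), (0, 1))
  | s + 1 =>
    ((lpair n s).2,
      ((lpair n s).1.1 - (equot x₀ x₁ (n + s) : ℤ) * (lpair n s).2.1,
        (lpair n s).1.2 - (equot x₀ x₁ (n + s) : ℤ) * (lpair n s).2.2))

/-- `A_s`. [folklore] -/
def lA (n s : ℕ) : ℤ := (lpair x₀ x₁ n s).1.1

/-- `B_s`. [folklore] -/
def lB (n s : ℕ) : ℤ := (lpair x₀ x₁ n s).1.2

/-- `A_{s+2} = A_s − q_{n+s} A_{s+1}`. [folklore] -/
theorem lA_add_two (n s : ℕ) :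
    lA x₀ x₁ n (s + 2) = lA x₀ x₁ n s - (equot x₀ x₁ (n + s) : ℤ) * lA x₀ x₁ n (s + 1) := rfl

/-- `B_{s+2} = B_s − q_{n+s} B_{s+1}`. [folklore] -/
theorem lB_add_two (n s : ℕ) :
    lB x₀ x₁ n (s + 2) = lB x₀ x₁ n s - (equot x₀ x₁ (n + s) : ℤ) * lB x₀ x₁ n (s + 1) := rfl

/-- `r_{n+s} = A_s r_n + B_s r_{n+1}` (two consecutive instances, for the induction).
[folklore] -/
theorem erem_eq_lin₂ (n s : ℕ) :
    erem x₀ x₁ (n + s) = (lA x₀ x₁ n s : ℝ) * erem x₀ x₁ n + (lB x₀ x₁ n s : ℝ) * erem x₀ x₁ (n + 1)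
    ∧ erem x₀ x₁ (n + (s + 1)) =
      (lA x₀ x₁ n (s + 1) : ℝ) * erem x₀ x₁ n + (lB x₀ x₁ n (s + 1) : ℝ) * erem x₀ x₁ (n + 1) := by
  induction s with
  | zero => simp [lA, lB, lpair]
  | succ s ih =>
    refine ⟨ih.2, ?_⟩
    have e : n + (s + 1 + 1) = (n + s) + 2 := by ring
    rw [e, erem_add_two, lA_add_two, lB_add_two]
    have e1 : n + s + 1 = n + (s + 1) := by ring
    rw [e1, ih.1, ih.2]
    push_cast
    ring

/-- `r_{n+s} = A_s r_n + B_s r_{n+1}`. [folklore] -/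
theorem erem_eq_lin (n s : ℕ) :
    erem x₀ x₁ (n + s) =
      (lA x₀ x₁ n s : ℝ) * erem x₀ x₁ n + (lB x₀ x₁ n s : ℝ) * erem x₀ x₁ (n + 1) :=
  (erem_eq_lin₂ x₀ x₁ n s).1

/-- Growth of the local coefficients under a quotient bound `q_j ≤ K − 1` (`j ≥ n`):
`|A_s| ≤ Kˢ` (two consecutive instances). [folklore] -/
theorem abs_lA_le₂ (n : ℕ) {K : ℤ} (hK : 1 ≤ K)
    (hq : ∀ j, n ≤ j → (equot x₀ x₁ j : ℤ) ≤ K - 1) (s : ℕ) :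
    |lA x₀ x₁ n s| ≤ K ^ s ∧ |lA x₀ x₁ n (s + 1)| ≤ K ^ (s + 1) := by
  induction s with
  | zero =>
    simp only [lA, lpair, pow_zero, zero_add, pow_one, abs_one, le_refl, abs_zero, true_and]
    linarith
  | succ s ih =>
    refine ⟨ih.2, ?_⟩
    rw [show s + 1 + 1 = s + 2 by ring, lA_add_two]
    have hqs := hq (n + s) (Nat.le_add_right n s)
    have hq0 : (0 : ℤ) ≤ (equot x₀ x₁ (n + s) : ℤ) := Int.natCast_nonneg _
    have hKs : (0 : ℤ) ≤ K ^ s := pow_nonneg (by linarith) s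
    calc |lA x₀ x₁ n s - (equot x₀ x₁ (n + s) : ℤ) * lA x₀ x₁ n (s + 1)|
        ≤ |lA x₀ x₁ n s| + |(equot x₀ x₁ (n + s) : ℤ) * lA x₀ x₁ n (s + 1)| := abs_sub _ _
      _ = |lA x₀ x₁ n s| + (equot x₀ x₁ (n + s) : ℤ) * |lA x₀ x₁ n (s + 1)| := by
          rw [abs_mul, abs_of_nonneg hq0]
      _ ≤ K ^ s + (K - 1) * K ^ (s + 1) := by
          gcongr
          · exact ih.1
          · exact ih.2
      _ ≤ K ^ (s + 2) := by
          have : K ^ (s + 2) - (K ^ s + (K - 1) * K ^ (s + 1)) = K ^ s * (K - 1) := by ring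
          nlinarith

/-- `|A_s| ≤ Kˢ` under the quotient bound. [folklore] -/
theorem abs_lA_le (n : ℕ) {K : ℤ} (hK : 1 ≤ K)
    (hq : ∀ j, n ≤ j → (equot x₀ x₁ j : ℤ) ≤ K - 1) (s : ℕ) : |lA x₀ x₁ n s| ≤ K ^ s :=
  (abs_lA_le₂ x₀ x₁ n hK hq s).1

variable {x₀ x₁}

/-- `A_s ≠ 0` for `s ≥ 2` (else `r_{n+s} = B_s r_{n+1}` with `0 < r_{n+s} < r_{n+1}` and
`B_s ∈ ℤ`). [folklore] -/
theorem lA_ne_zero (hx : Irrational (x₀ / x₁)) (h0 : 0 < x₀) (h1 : 0 < x₁) (n s : ℕ)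
    (hs : 2 ≤ s) : lA x₀ x₁ n s ≠ 0 := by
  intro hA
  have hlin := erem_eq_lin x₀ x₁ n s
  rw [hA, Int.cast_zero, zero_mul, zero_add] at hlin
  have hpos := erem_pos hx h0 h1 (n + s)
  have hr1 := erem_pos hx h0 h1 (n + 1)
  obtain ⟨s', rfl⟩ : ∃ s', s = s' + 2 := ⟨s - 2, by omega⟩
  have hlt : erem x₀ x₁ (n + (s' + 2)) < erem x₀ x₁ (n + 1) := by
    have h2 := erem_anti hx h0 h1 (a := n + 1) (b := n + s' + 1) (by omega)
    have e : n + (s' + 2) = n + s' + 1 + 1 := by ring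
    rw [e]
    exact lt_of_le_of_lt h2 (erem_lt hx h0 h1 n)
  have hBpos : (0 : ℝ) < (lB x₀ x₁ n (s' + 2) : ℝ) := by
    rw [hlin] at hpos
    exact pos_of_mul_pos_left hpos hr1.le
  have hB1 : (1 : ℝ) ≤ (lB x₀ x₁ n (s' + 2) : ℝ) := by
    have : (0 : ℤ) < lB x₀ x₁ n (s' + 2) := by exact_mod_cast hBpos
    exact_mod_cast this
  rw [hlin] at hlt
  nlinarith

end Chain

/-! ### An elementary covering statement on the circle -/

/-- Stepping a real number by `±δ` with `0 < δ ≤ L < 1`: within `δ⁻¹ + 1` steps its fractional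
part lands in `(0, L]`. [folklore] -/
theorem exists_fract_mem (c δ L : ℝ) (hδ : 0 < δ) (hδL : δ ≤ L) (hL1 : L < 1) (s : ℝ)
    (hs : s = 1 ∨ s = -1) :
    ∃ j : ℕ, (j : ℝ) ≤ 1 / δ + 1 ∧ 0 < Int.fract (c + s * ((j : ℝ) * δ)) ∧
      Int.fract (c + s * ((j : ℝ) * δ)) ≤ L := by
  rcases hs with rfl | rfl
  · -- stepping up: pass the next integer `m = ⌊c⌋ + 1`, at distance `g = 1 − fract c ∈ (0,1]`
    set g : ℝ := 1 - Int.fract c with hg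
    have hg0 : 0 < g := by have := Int.fract_lt_one c; linarith
    have hg1 : g ≤ 1 := by have := Int.fract_nonneg c; linarith
    set j : ℕ := ⌊g / δ⌋₊ + 1 with hj
    have hjg : g < (j : ℝ) * δ := by
      have := Nat.lt_floor_add_one (g / δ)
      rw [div_lt_iff₀ hδ] at this
      rw [hj]
      push_cast
      linarith
    have hjg' : (j : ℝ) * δ ≤ g + δ := by
      have := Nat.floor_le (div_nonneg hg0.le hδ.le)
      rw [le_div_iff₀ hδ] at this
      rw [hj]
      push_cast
      linarith
    refine ⟨j, ?_, ?_⟩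
    · rw [hj]
      push_cast
      have := Nat.floor_le (div_nonneg hg0.le hδ.le)
      have : g / δ ≤ 1 / δ := div_le_div_of_nonneg_right hg1 hδ.le
      linarith
    · have hfl : ⌊c + 1 * ((j : ℝ) * δ)⌋ = ⌊c⌋ + 1 := by
        rw [Int.floor_eq_iff]
        have := Int.floor_add_fract c
        push_cast
        constructor <;> linarith
      have hfr : Int.fract (c + 1 * ((j : ℝ) * δ)) = (j : ℝ) * δ - g := by
        rw [Int.fract, hfl, hg, Int.fract]
        push_cast
        ring
      rw [hfr]
      constructor <;> linarith
  · -- stepping down: pass `⌊c − L⌋ + L`, at distance `S = fract (c − L) ∈ [0,1)`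
    set S : ℝ := Int.fract (c - L) with hS
    have hS0 : 0 ≤ S := Int.fract_nonneg _
    have hS1 : S < 1 := Int.fract_lt_one _
    set j : ℕ := ⌈S / δ⌉₊ with hj
    have hjS : S ≤ (j : ℝ) * δ := by
      have := Nat.le_ceil (S / δ)
      rw [← hj] at this
      rwa [div_le_iff₀ hδ] at this
    have hjS' : (j : ℝ) * δ < S + δ := by
      have := Nat.ceil_lt_add_one (div_nonneg hS0 hδ.le)
      rw [← hj, div_add_one hδ.ne', lt_div_iff₀ hδ] at this
      linarith
    refine ⟨j, ?_, ?_⟩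
    · have := Nat.ceil_lt_add_one (div_nonneg hS0 hδ.le)
      rw [← hj] at this
      have : S / δ ≤ 1 / δ := div_le_div_of_nonneg_right hS1.le hδ.le
      linarith
    · have hfl : ⌊c + -1 * ((j : ℝ) * δ)⌋ = ⌊c - L⌋ := by
        rw [Int.floor_eq_iff]
        have := Int.floor_add_fract (c - L)
        constructor <;> linarith
      have hfr : Int.fract (c + -1 * ((j : ℝ) * δ)) = S + L - (j : ℝ) * δ := by
        rw [Int.fract, hfl, hS, Int.fract]
        ring
      rw [hfr]
      constructor <;> linarith

/-- `y − ⌊y/x⌋ x = fract(y/x) · x` for `y ≥ 0`, `x > 0`. [folklore] -/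
theorem sub_floor_mul_eq_fract_mul {y x : ℝ} (hy : 0 ≤ y) (hx : 0 < x) :
    y - (⌊y / x⌋₊ : ℝ) * x = Int.fract (y / x) * x := by
  have h1 : ((⌊y / x⌋₊ : ℕ) : ℝ) = ((⌊y / x⌋ : ℤ) : ℝ) := by
    have := Int.natCast_floor_eq_floor (div_nonneg hy hx.le)
    exact_mod_cast this
  rw [h1, Int.fract, sub_mul, div_mul_cancel₀ _ hx.ne']

end Lattice94

end Literature.AlgebraicGeometry.CossartPiltant200819.CP2008

end
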